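import Literature.NumberTheory.IwasawaTheory.ClassicalMuVanishesSplitCartanFiveDescent
import Literature.NumberTheory.SerreUniformity.SplitCartan
import Mathlib.GroupTheory.PGroup
import HarnessLib

set_option autoImplicit false

/-!
# `μ = 0` for `ℚ(E[5])_cyc` from a split-Cartan mod-5 image: the bridge from a faithful matrix representation
# `Gal(L/ℚ) ↪ M₂(𝔽₅)` with values in `C_s⁺(5)` to the `N_s(5)` Kuroda census form

Topic `NumberTheory/IwasawaTheory` (namespace = path).  THEOREM-ONLY file (no definition, no named fact, no `sorry`);
literature seat `bsd-potss-conjA-anchor` g11 (supports stmt-BirchSwinnertonDyer-19413, KT rows with split Cartan image at `5`; closes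
nothing).  `ClassicalMuVanishesSplitCartanFiveDescent.classicalMuVanishes_of_isCyclotomic_of_splitCartan_kuroda_rat` asks for
ELEMENTS `u, v, w` of `Gal(L/ℚ)` with the relations of `N_s(5)`.  Here those relations are DERIVED from a faithful representation
`ρ : Gal(L/ℚ) →* M₂(𝔽₅)` with values in `SerreUniformity.splitCartanNormalizer 5` and `ρ u = diag(2,1)`, `ρ v = diag(1,2)`,
`ρ w = (0 1; 1 0)` — all finite facts about the 32 matrices of `C_s⁺(5)` by `decide` on entry-parametrised shapes:
`classicalMuVanishes_of_isCyclotomic_of_splitCartanNormalizer_five_fixedField`.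

References: [Serre1972, §2.2 (split Cartan subgroups and their normalisers)]; [BiluParentRebolledo2013, §1]; [Lemmermeyer1994, §1];
[Washington1997, §7.5, §13.1].
-/

noncomputable section

open scoped NumberField

open Field IntermediateField Literature.NumberTheory.EllipticCurves Literature.NumberTheory.SerreUniformity

namespace Literature.NumberTheory.IwasawaTheory

/-! ### §0 Finite facts about `C_s⁺(5) ⊂ GL₂(𝔽₅)` (by `decide`) -/

section Matrices

/-- An element of `splitCartanNormalizer 5` is `(a 0; 0 d)` with `ad ≠ 0` or `(0 b; c 0)` with `bc ≠ 0`. [folklore] -/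
private theorem shape_of_mem_splitCartanNormalizer₅ {M : Matrix (Fin 2) (Fin 2) (ZMod 5)}
    (hM : M ∈ splitCartanNormalizer 5) :
    (∃ a d : ZMod 5, a * d ≠ 0 ∧ M = !![a, 0; 0, d]) ∨ (∃ b c : ZMod 5, b * c ≠ 0 ∧ M = !![0, b; c, 0]) := by
  obtain ⟨hdet, h | h⟩ := hM
  · refine Or.inl ⟨M 0 0, M 1 1, ?_, ?_⟩
    · simpa only [Matrix.det_fin_two, h.1, h.2, mul_zero, sub_zero] using hdet
    · exact Matrix.ext fun i j => by fin_cases i <;> fin_cases j <;> simp [h.1, h.2]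
  · refine Or.inr ⟨M 0 1, M 1 0, ?_, ?_⟩
    · have h' : -(M 0 1 * M 1 0) ≠ 0 := by
        simpa only [Matrix.det_fin_two, h.1, h.2, zero_mul, zero_sub] using hdet
      exact neg_ne_zero.mp h'
    · exact Matrix.ext fun i j => by fin_cases i <;> fin_cases j <;> simp [h.1, h.2]

/-- Commutators in `C_s⁺(5)` lie in `{1, D, D², D³}`, `D = diag(2, 3)`: diagonal–diagonal. [folklore] -/
private theorem dd_comm₅ : ∀ a d a' d' : ZMod 5,
    (!![a, 0; 0, d] : Matrix (Fin 2) (Fin 2) (ZMod 5)) * !![a', 0; 0, d'] = !![a', 0; 0, d'] * !![a, 0; 0, d] := by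
  decide

/-- Commutators in `C_s⁺(5)`: diagonal–antidiagonal. [folklore] -/
private theorem da_comm₅ : ∀ a d b c : ZMod 5, a * d ≠ 0 → b * c ≠ 0 →
    (!![a, 0; 0, d] : Matrix (Fin 2) (Fin 2) (ZMod 5)) * !![0, b; c, 0] = !![0, b; c, 0] * !![a, 0; 0, d] ∨
    (!![a, 0; 0, d] : Matrix (Fin 2) (Fin 2) (ZMod 5)) * !![0, b; c, 0] = !![2, 0; 0, 3] * (!![0, b; c, 0] * !![a, 0; 0, d]) ∨
    (!![a, 0; 0, d] : Matrix (Fin 2) (Fin 2) (ZMod 5)) * !![0, b; c, 0] =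
      !![2, 0; 0, 3] * !![2, 0; 0, 3] * (!![0, b; c, 0] * !![a, 0; 0, d]) ∨
    (!![a, 0; 0, d] : Matrix (Fin 2) (Fin 2) (ZMod 5)) * !![0, b; c, 0] =
      !![2, 0; 0, 3] * !![2, 0; 0, 3] * !![2, 0; 0, 3] * (!![0, b; c, 0] * !![a, 0; 0, d]) := by
  decide

/-- Commutators in `C_s⁺(5)`: antidiagonal–diagonal. [folklore] -/
private theorem ad_comm₅ : ∀ b c a d : ZMod 5, b * c ≠ 0 → a * d ≠ 0 →
    (!![0, b; c, 0] : Matrix (Fin 2) (Fin 2) (ZMod 5)) * !![a, 0; 0, d] = !![a, 0; 0, d] * !![0, b; c, 0] ∨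
    (!![0, b; c, 0] : Matrix (Fin 2) (Fin 2) (ZMod 5)) * !![a, 0; 0, d] = !![2, 0; 0, 3] * (!![a, 0; 0, d] * !![0, b; c, 0]) ∨
    (!![0, b; c, 0] : Matrix (Fin 2) (Fin 2) (ZMod 5)) * !![a, 0; 0, d] =
      !![2, 0; 0, 3] * !![2, 0; 0, 3] * (!![a, 0; 0, d] * !![0, b; c, 0]) ∨
    (!![0, b; c, 0] : Matrix (Fin 2) (Fin 2) (ZMod 5)) * !![a, 0; 0, d] =
      !![2, 0; 0, 3] * !![2, 0; 0, 3] * !![2, 0; 0, 3] * (!![a, 0; 0, d] * !![0, b; c, 0]) := by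
  decide

/-- Commutators in `C_s⁺(5)`: antidiagonal–antidiagonal. [folklore] -/
private theorem aa_comm₅ : ∀ b c b' c' : ZMod 5, b * c ≠ 0 → b' * c' ≠ 0 →
    (!![0, b; c, 0] : Matrix (Fin 2) (Fin 2) (ZMod 5)) * !![0, b'; c', 0] = !![0, b'; c', 0] * !![0, b; c, 0] ∨
    (!![0, b; c, 0] : Matrix (Fin 2) (Fin 2) (ZMod 5)) * !![0, b'; c', 0] = !![2, 0; 0, 3] * (!![0, b'; c', 0] * !![0, b; c, 0]) ∨
    (!![0, b; c, 0] : Matrix (Fin 2) (Fin 2) (ZMod 5)) * !![0, b'; c', 0] =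
      !![2, 0; 0, 3] * !![2, 0; 0, 3] * (!![0, b'; c', 0] * !![0, b; c, 0]) ∨
    (!![0, b; c, 0] : Matrix (Fin 2) (Fin 2) (ZMod 5)) * !![0, b'; c', 0] =
      !![2, 0; 0, 3] * !![2, 0; 0, 3] * !![2, 0; 0, 3] * (!![0, b'; c', 0] * !![0, b; c, 0]) := by
  decide

/-- `A C = D^k C A` for `A, C ∈ C_s⁺(5)`, `D = diag(2,3)`, some `k ≤ 3`. [folklore] -/
private theorem mul_eq_of_mem₅ {A C : Matrix (Fin 2) (Fin 2) (ZMod 5)} (hA : A ∈ splitCartanNormalizer 5)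
    (hC : C ∈ splitCartanNormalizer 5) :
    A * C = C * A ∨ A * C = !![2, 0; 0, 3] * (C * A) ∨ A * C = !![2, 0; 0, 3] * !![2, 0; 0, 3] * (C * A) ∨
      A * C = !![2, 0; 0, 3] * !![2, 0; 0, 3] * !![2, 0; 0, 3] * (C * A) := by
  rcases shape_of_mem_splitCartanNormalizer₅ hA with ⟨a, d, had, rfl⟩ | ⟨b, c, hbc, rfl⟩ <;>
    rcases shape_of_mem_splitCartanNormalizer₅ hC with ⟨a', d', had', rfl⟩ | ⟨b', c', hbc', rfl⟩
  · exact Or.inl (dd_comm₅ a d a' d')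
  · exact da_comm₅ a d b' c' had hbc'
  · exact ad_comm₅ b c a' d' hbc had'
  · exact aa_comm₅ b c b' c' hbc hbc'

/-- Every element of `C_s⁺(5)` has order dividing `8`: diagonal. [folklore] -/
private theorem d_pow_eight₅ : ∀ a d : ZMod 5, a * d ≠ 0 → (!![a, 0; 0, d] : Matrix (Fin 2) (Fin 2) (ZMod 5)) ^ 8 = 1 := by
  decide

/-- Every element of `C_s⁺(5)` has order dividing `8`: antidiagonal. [folklore] -/
private theorem a_pow_eight₅ : ∀ b c : ZMod 5, b * c ≠ 0 → (!![0, b; c, 0] : Matrix (Fin 2) (Fin 2) (ZMod 5)) ^ 8 = 1 := by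
  decide

/-- Every element of `C_s⁺(5)` has order dividing `8`. [folklore] -/
private theorem pow_eight_eq_one_of_mem₅ {A : Matrix (Fin 2) (Fin 2) (ZMod 5)} (hA : A ∈ splitCartanNormalizer 5) :
    A ^ 8 = 1 := by
  rcases shape_of_mem_splitCartanNormalizer₅ hA with ⟨a, d, had, rfl⟩ | ⟨b, c, hbc, rfl⟩
  exacts [d_pow_eight₅ a d had, a_pow_eight₅ b c hbc]

/-- The scalar `diag(2,2)` is central: diagonal shape. [folklore] -/
private theorem d_scalar_comm₅ : ∀ a d : ZMod 5,
    (!![a, 0; 0, d] : Matrix (Fin 2) (Fin 2) (ZMod 5)) * !![2, 0; 0, 2] = !![2, 0; 0, 2] * !![a, 0; 0, d] := by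
  decide

/-- The scalar `diag(2,2)` is central: antidiagonal shape. [folklore] -/
private theorem a_scalar_comm₅ : ∀ b c : ZMod 5,
    (!![0, b; c, 0] : Matrix (Fin 2) (Fin 2) (ZMod 5)) * !![2, 0; 0, 2] = !![2, 0; 0, 2] * !![0, b; c, 0] := by
  decide

/-- `diag(2,2)` commutes with every element of `C_s⁺(5)`. [folklore] -/
private theorem scalar_comm_of_mem₅ {A : Matrix (Fin 2) (Fin 2) (ZMod 5)} (hA : A ∈ splitCartanNormalizer 5) :
    A * !![2, 0; 0, 2] = !![2, 0; 0, 2] * A := by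
  rcases shape_of_mem_splitCartanNormalizer₅ hA with ⟨a, d, _, rfl⟩ | ⟨b, c, _, rfl⟩
  exacts [d_scalar_comm₅ a d, a_scalar_comm₅ b c]

/-- Conjugating `diag(4,1)` by an element of `C_s⁺(5)` gives `diag(4,1)` or `diag(1,4)`: diagonal shape. [folklore] -/
private theorem d_conj_sq₅ : ∀ a d : ZMod 5,
    ((!![a, 0; 0, d] : Matrix (Fin 2) (Fin 2) (ZMod 5)) * !![4, 0; 0, 1] = !![4, 0; 0, 1] * !![a, 0; 0, d] ∨
      (!![a, 0; 0, d] : Matrix (Fin 2) (Fin 2) (ZMod 5)) * !![4, 0; 0, 1] = !![1, 0; 0, 4] * !![a, 0; 0, d]) ∧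
    ((!![a, 0; 0, d] : Matrix (Fin 2) (Fin 2) (ZMod 5)) * !![1, 0; 0, 4] = !![4, 0; 0, 1] * !![a, 0; 0, d] ∨
      (!![a, 0; 0, d] : Matrix (Fin 2) (Fin 2) (ZMod 5)) * !![1, 0; 0, 4] = !![1, 0; 0, 4] * !![a, 0; 0, d]) := by
  decide

/-- Conjugating `diag(4,1)` / `diag(1,4)` by an antidiagonal element swaps them. [folklore] -/
private theorem a_conj_sq₅ : ∀ b c : ZMod 5,
    ((!![0, b; c, 0] : Matrix (Fin 2) (Fin 2) (ZMod 5)) * !![4, 0; 0, 1] = !![4, 0; 0, 1] * !![0, b; c, 0] ∨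
      (!![0, b; c, 0] : Matrix (Fin 2) (Fin 2) (ZMod 5)) * !![4, 0; 0, 1] = !![1, 0; 0, 4] * !![0, b; c, 0]) ∧
    ((!![0, b; c, 0] : Matrix (Fin 2) (Fin 2) (ZMod 5)) * !![1, 0; 0, 4] = !![4, 0; 0, 1] * !![0, b; c, 0] ∨
      (!![0, b; c, 0] : Matrix (Fin 2) (Fin 2) (ZMod 5)) * !![1, 0; 0, 4] = !![1, 0; 0, 4] * !![0, b; c, 0]) := by
  decide

/-- `V₀ = {diag(±1,±1)}` is normalised by `C_s⁺(5)` (on the generators `diag(4,1)`, `diag(1,4)`). [folklore] -/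
private theorem conj_sq_of_mem₅ {A : Matrix (Fin 2) (Fin 2) (ZMod 5)} (hA : A ∈ splitCartanNormalizer 5) :
    (A * !![4, 0; 0, 1] = !![4, 0; 0, 1] * A ∨ A * !![4, 0; 0, 1] = !![1, 0; 0, 4] * A) ∧
      (A * !![1, 0; 0, 4] = !![4, 0; 0, 1] * A ∨ A * !![1, 0; 0, 4] = !![1, 0; 0, 4] * A) := by
  rcases shape_of_mem_splitCartanNormalizer₅ hA with ⟨a, d, _, rfl⟩ | ⟨b, c, _, rfl⟩
  exacts [d_conj_sq₅ a d, a_conj_sq₅ b c]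

/-- The relations among `U = diag(2,1)`, `V = diag(1,2)`, `W = (0 1; 1 0)` used below. [folklore] -/
private theorem uvw_facts₅ :
    (!![2, 0; 0, 1] : Matrix (Fin 2) (Fin 2) (ZMod 5)) * !![1, 0; 0, 2] = !![1, 0; 0, 2] * !![2, 0; 0, 1] ∧
    (!![2, 0; 0, 1] : Matrix (Fin 2) (Fin 2) (ZMod 5)) * !![2, 0; 0, 1] * (!![2, 0; 0, 1] * !![2, 0; 0, 1]) = 1 ∧
    (!![1, 0; 0, 2] : Matrix (Fin 2) (Fin 2) (ZMod 5)) * !![1, 0; 0, 2] * (!![1, 0; 0, 2] * !![1, 0; 0, 2]) = 1 ∧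
    (!![0, 1; 1, 0] : Matrix (Fin 2) (Fin 2) (ZMod 5)) * !![0, 1; 1, 0] = 1 ∧
    (!![0, 1; 1, 0] : Matrix (Fin 2) (Fin 2) (ZMod 5)) * !![2, 0; 0, 1] * !![0, 1; 1, 0] = !![1, 0; 0, 2] ∧
    (!![0, 1; 1, 0] : Matrix (Fin 2) (Fin 2) (ZMod 5)) * !![1, 0; 0, 2] * !![0, 1; 1, 0] = !![2, 0; 0, 1] ∧
    (!![2, 0; 0, 1] : Matrix (Fin 2) (Fin 2) (ZMod 5)) * !![1, 0; 0, 2] = !![2, 0; 0, 2] ∧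
    (!![2, 0; 0, 1] : Matrix (Fin 2) (Fin 2) (ZMod 5)) * !![2, 0; 0, 1] = !![4, 0; 0, 1] ∧
    (!![1, 0; 0, 2] : Matrix (Fin 2) (Fin 2) (ZMod 5)) * !![1, 0; 0, 2] = !![1, 0; 0, 4] ∧
    (!![2, 0; 0, 1] : Matrix (Fin 2) (Fin 2) (ZMod 5)) * (!![1, 0; 0, 2] * !![1, 0; 0, 2] * !![1, 0; 0, 2]) =
      !![2, 0; 0, 3] := by
  decide

end Matrices

/-! ### §1 The bridge -/

/-- **`μ = 0` for the cyclotomic `ℤ_5`-tower of `L` from a faithful `C_s⁺(5)`-valued representation of `Gal(L/ℚ)`, modulo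
Ferrero–Washington alone — fixed-field form.**  `L/ℚ` finite Galois; `ρ : Gal(L/ℚ) →* M₂(𝔽₅)` injective with every `ρ(g)` in
`splitCartanNormalizer 5`; `u, v, w ∈ Gal(L/ℚ)` with `ρ u = diag(2,1)`, `ρ v = diag(1,2)`, `ρ w = (0 1; 1 0)` (for `L = ℚ(E[5])` with
image all of `C_s⁺(5)` in the basis `(P₁, P₂)`: `L^{⟨v⟩} = ℚ(P₁)`, `L^{⟨u², v⟩} = ℚ(x P₁)`, `L^{⟨uv, w⟩} = ℚ(⟨P₁ + P₂⟩)`).  If `μ = 0`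
holds for every cyclotomic `ℤ_5`-extension of `L^{⟨v⟩}`, `L^{⟨u²v⟩}`, `L^{⟨u²⟩ ⊔ ⟨v⟩}` and `L^{⟨uv⟩ ⊔ ⟨w⟩}`, then — under
`ferreroWashington1979_classicalMuVanishes` — for every cyclotomic `ℤ_5`-extension of `L`.  All relations of
`classicalMuVanishes_of_isCyclotomic_of_splitCartan_kuroda_rat` are read off the 32 matrices of `C_s⁺(5)` by `decide`
(commutators in `⟨diag(2,3)⟩ = ρ⟨u v⁻¹⟩`, `diag(2,2) = ρ(uv)` central, `⟨diag(4,1), diag(1,4)⟩ = ρ⟨u², v²⟩` normal, `g⁸ = 1` so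
`5 ∤ [L:ℚ]`). [cite: Serre1972, §2.2 (split Cartan subgroups, normalisers)]
[cite: Lemmermeyer1994, §1 (Kuroda's class number formula, odd part)] [cite: Washington1997, §7.5, §13.1] -/
theorem classicalMuVanishes_of_isCyclotomic_of_splitCartanNormalizer_five_fixedField
    (hFW : ferreroWashington1979_classicalMuVanishes) [Fact (Nat.Prime 5)] (L : Type) [Field L] [NumberField L] [IsGalois ℚ L]
    (ρ : (L ≃ₐ[ℚ] L) →* Matrix (Fin 2) (Fin 2) (ZMod 5)) (hρ : Function.Injective ρ)
    (himg : ∀ g, ρ g ∈ splitCartanNormalizer 5) {u v w : L ≃ₐ[ℚ] L} (hu : ρ u = !![2, 0; 0, 1])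
    (hv : ρ v = !![1, 0; 0, 2]) (hw : ρ w = !![0, 1; 1, 0])
    (hμP : ∀ κE : ZpExtension ↥(fixedField (Subgroup.zpowers v)) 5, κE.IsCyclotomic → ClassicalMuVanishes κE)
    (hμD : ∀ κE : ZpExtension ↥(fixedField (Subgroup.zpowers (u * u * v))) 5, κE.IsCyclotomic → ClassicalMuVanishes κE)
    (hμX : ∀ κE : ZpExtension ↥(fixedField (Subgroup.zpowers (u * u) ⊔ Subgroup.zpowers v)) 5,
      κE.IsCyclotomic → ClassicalMuVanishes κE)
    (hμC : ∀ κE : ZpExtension ↥(fixedField (Subgroup.zpowers (u * v) ⊔ Subgroup.zpowers w)) 5,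
      κE.IsCyclotomic → ClassicalMuVanishes κE)
    (κL : ZpExtension L 5) (hκL : κL.IsCyclotomic) : ClassicalMuVanishes κL := by
  obtain ⟨fUV, fU4, fV4, fW2, fWUW, fWVW, fUVs, fUU, fVV, fD⟩ := uvw_facts₅
  -- relations among `u, v, w`
  have huv : u * v = v * u := hρ (by rw [map_mul, map_mul, hu, hv, fUV])
  have hu4 : u * u * (u * u) = 1 := hρ (by simp only [map_mul, map_one, hu]; exact fU4)
  have hv4 : v * v * (v * v) = 1 := hρ (by simp only [map_mul, map_one, hv]; exact fV4)
  have hw2 : w * w = 1 := hρ (by rw [map_mul, hw, fW2, map_one])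
  have hwinv : w⁻¹ = w := inv_eq_of_mul_eq_one_right hw2
  have hwu : w * u * w⁻¹ = v := by rw [hwinv]; exact hρ (by rw [map_mul, map_mul, hw, hu, fWUW, hv])
  have hwv : w * v * w⁻¹ = u := by rw [hwinv]; exact hρ (by rw [map_mul, map_mul, hw, hv, fWVW, hu])
  have hρuv : ρ (u * v) = !![2, 0; 0, 2] := by rw [map_mul, hu, hv, fUVs]
  have hρuu : ρ (u * u) = !![4, 0; 0, 1] := by rw [map_mul, hu, fUU]
  have hρvv : ρ (v * v) = !![1, 0; 0, 4] := by rw [map_mul, hv, fVV]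
  have hvinv : v⁻¹ = v * v * v := inv_eq_of_mul_eq_one_right (by rw [← hv4]; group)
  have hρD : ρ (u * v⁻¹) = !![2, 0; 0, 3] := by rw [hvinv]; simp only [map_mul, hu, hv]; exact fD
  -- `uv` central
  have hsc : ∀ g : L ≃ₐ[ℚ] L, g * (u * v) = (u * v) * g := fun g =>
    hρ (by rw [map_mul ρ g (u * v), map_mul ρ (u * v) g, hρuv]; exact scalar_comm_of_mem₅ (himg g))
  -- `⟨u², v²⟩` normal
  have hVu : ∀ g : L ≃ₐ[ℚ] L, g * (u * u) * g⁻¹ = u * u ∨ g * (u * u) * g⁻¹ = v * v := by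
    intro g
    rcases (conj_sq_of_mem₅ (himg g)).1 with h | h
    · left
      rw [mul_inv_eq_iff_eq_mul]
      exact hρ (by rw [map_mul ρ g (u * u), map_mul ρ (u * u) g, hρuu]; exact h)
    · right
      rw [mul_inv_eq_iff_eq_mul]
      exact hρ (by rw [map_mul ρ g (u * u), map_mul ρ (v * v) g, hρuu, hρvv]; exact h)
  have hVv : ∀ g : L ≃ₐ[ℚ] L, g * (v * v) * g⁻¹ = u * u ∨ g * (v * v) * g⁻¹ = v * v := by
    intro g
    rcases (conj_sq_of_mem₅ (himg g)).2 with h | h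
    · left
      rw [mul_inv_eq_iff_eq_mul]
      exact hρ (by rw [map_mul ρ g (v * v), map_mul ρ (u * u) g, hρuu, hρvv]; exact h)
    · right
      rw [mul_inv_eq_iff_eq_mul]
      exact hρ (by rw [map_mul ρ g (v * v), map_mul ρ (v * v) g, hρvv]; exact h)
  -- commutators in `⟨u v⁻¹⟩`
  have hcomm : ∀ a c : L ≃ₐ[ℚ] L, a * c * a⁻¹ * c⁻¹ ∈ Subgroup.zpowers (u * v⁻¹) := by
    intro a c
    have key : ∀ x : L ≃ₐ[ℚ] L, a * c = x * (c * a) → a * c * a⁻¹ * c⁻¹ = x := fun x hx => by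
      rw [show a * c * a⁻¹ * c⁻¹ = (a * c) * (c * a)⁻¹ by group, hx]; group
    rcases mul_eq_of_mem₅ (himg a) (himg c) with h | h | h | h
    · rw [key 1 (by rw [one_mul]; exact hρ (by rw [map_mul ρ a c, map_mul ρ c a]; exact h))]
      exact Subgroup.one_mem _
    · rw [key (u * v⁻¹) (hρ (by rw [map_mul ρ a c, map_mul ρ (u * v⁻¹) (c * a), map_mul ρ c a, hρD]; exact h))]
      exact Subgroup.mem_zpowers _
    · rw [key (u * v⁻¹ * (u * v⁻¹)) (hρ (by
        rw [map_mul ρ a c, map_mul ρ (u * v⁻¹ * (u * v⁻¹)) (c * a), map_mul ρ (u * v⁻¹) (u * v⁻¹), map_mul ρ c a, hρD]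
        exact h))]
      exact (Subgroup.zpowers _).mul_mem (Subgroup.mem_zpowers _) (Subgroup.mem_zpowers _)
    · rw [key (u * v⁻¹ * (u * v⁻¹) * (u * v⁻¹)) (hρ (by
        rw [map_mul ρ a c, map_mul ρ (u * v⁻¹ * (u * v⁻¹) * (u * v⁻¹)) (c * a), map_mul ρ (u * v⁻¹ * (u * v⁻¹)) (u * v⁻¹),
          map_mul ρ (u * v⁻¹) (u * v⁻¹), map_mul ρ c a, hρD]
        exact h))]
      exact (Subgroup.zpowers _).mul_mem ((Subgroup.zpowers _).mul_mem (Subgroup.mem_zpowers _)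
        (Subgroup.mem_zpowers _)) (Subgroup.mem_zpowers _)
  -- `Gal(L/ℚ)` is a `2`-group, so `5 ∤ [L : ℚ]`
  have hp : ¬ 5 ∣ Module.finrank ℚ L := by
    haveI : Fact (Nat.Prime 2) := ⟨Nat.prime_two⟩
    have h2 : IsPGroup 2 (L ≃ₐ[ℚ] L) := fun g => ⟨3, hρ (by rw [map_pow, map_one]; exact pow_eight_eq_one_of_mem₅ (himg g))⟩
    obtain ⟨n, hn⟩ := IsPGroup.iff_card.mp h2
    rw [← IsGalois.card_aut_eq_finrank, hn]
    intro h
    have h5 : (5 : ℕ) ∣ 2 := (Nat.prime_five).dvd_of_dvd_pow h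
    omega
  exact classicalMuVanishes_of_isCyclotomic_of_splitCartan_kuroda_rat hFW (by decide) L hp huv hu4 hv4 hw2 hwu hwv hsc hVu hVv
    hcomm hμP hμD hμX hμC κL hκL

end Literature.NumberTheory.IwasawaTheory

end
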